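import Literature.MeasureTheory.Group.InvariantQuotientCompactOpenMass
import HarnessLib

/-!
# Unfolding against ADAPTED compact open sets: `μ(π(W))·ρ(S) ≤ c·ν(W)` for `W·S ⊆ W`, the doubling of a left-invariant
# measure along a strict chain of subgroups, and finiteness of `μ(⋃_{j ≥ j₀} π(K a^j))` for a contracting element `a`
(Deitmar–Echterhoff, *Principles of Harmonic Analysis* (2014), Thm. 1.5.3; Ranga Rao, Ann. of Math. 96 (1972) — the
group-theoretic skeleton of the convergence of unipotent orbital integrals; Harish-Chandra, *Admissible invariant
distributions on reductive p-adic groups* (1999), §3.1)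

Topic `MeasureTheory/Group`; namespace `Literature.MeasureTheory.Group`.  THEOREMS ONLY (no definition, no instance, no
notation, no named fact, no `sorry`).  Setting of ★ `InvariantQuotientUnfolding` ∕ ★ `InvariantQuotientCompactOpenMass`:
`G` a locally compact second countable Hausdorff group with Borel σ-algebra, `H ≤ G` a CLOSED subgroup carrying a
left-invariant measure `ρ` finite on compacts, `μ` a `G`-invariant measure on `G ⧸ H` finite on compacts, `ν` a Haar
measure on `G`, `c = unfoldingConstant H ρ μ ν` the (finite) constant of Weil's formula
`∫_{G⧸H} ∫_H f(g h) dρ dμ = c ∫_G f dν` (★ `lintegral_fiberLIntegral_eq_mul_lintegral`).  NO unimodularity of `H`, no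
inversion invariance of `ρ` is used anywhere in this file.

* §1 (any group `H` with a left-invariant measure `ρ`) **doubling along a strict chain**: `S < S'` subgroups, `S` measurable
  ⇒ `2·ρ(S) ≤ ρ(S')` (`S` and a coset `x·S`, `x ∈ S' ∖ S`, are disjoint inside `S'`); hence for a strict chain
  `S₀ < S₁ < ⋯` of measurable subgroups `2^j·ρ(S₀) ≤ ρ(S_j)` (`pow_mul_measure_le_of_chain`) — a residue-field-free
  substitute for index computations.
* §2 **the adapted unfolding bound** `measure_image_mk_mul_le_unfoldingConstant_mul`: for `W ⊆ G` open and `S ⊆ H` measurable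
  with `W·S ⊆ W`, `μ(π(W))·ρ(S) ≤ c·ν(W)` (Weil's formula on `f = 1_W`: the fibre integral of `1_W` is `≥ ρ(S)` at every
  point of `π(W)`).  With `W = K` a compact open subgroup and `S = H ∩ K` this is the `≤` half of ★
  `measure_image_mk_mul_eq_unfoldingConstant_mul`.
* §3 **right translates of a compact open subgroup**: `μ(π(K g)) < ∞` for every `g` (`measure_image_mk_mul_singleton_lt_top`;
  `W = K g`, `S = H ∩ g⁻¹Kg`, `ρ` positive on opens, `ν` right invariant), and the MAIN LEMMA
  `measure_iUnion_image_mk_mul_zpow_lt_top`: if `a ∈ G` normalises `H`, `K`-integrality inside `H` improves under `Ad(a)`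
  (`h ∈ H ∩ K ⇒ a h a⁻¹ ∈ K`) and STRICTLY so (some `h ∈ H ∖ K` has `a h a⁻¹ ∈ K`), then for every `j₀ : ℤ`
  **`μ(⋃_{j ≥ j₀} π(K a^j)) < ∞`** — the sets `S_j = H ∩ a^{−j}Ka^{j}` form a strict chain, `K a^j · S_j ⊆ K a^j`,
  `ν(K a^j) = ν(K)`, so `μ(π(K a^j)) ≤ c ν(K) ∕ (2^j ρ(S₀))` is summable over `j ≥ 0` and finite term by term for `j < 0`.
  This is the measure-theoretic skeleton of Ranga Rao's convergence theorem for unipotent orbital integrals on a rank-one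
  group (the consumer — cell `pub/hodgecm-mathlib`, crux H413 = `stmt-HodgeConjecture-24833`, F0∕P3c line LH4, organ
  RAO-CONV of the Shalika pay-down — supplies the covering `{y ∣ y u y⁻¹ ∈ C} ⊆ ⋃_{j ≥ j₀} K a^j G_u` from the Iwasawa
  decomposition).
* §4 (any topological group) `integrable_descConj_of_measure_preimage_lt_top`: if `μ{yM ∣ y γ₀ y⁻¹ ∈ C} < ∞` for all compact
  `C`, every continuous compactly supported orbital integrand `yM ↦ f(y γ₀ y⁻¹)` is `μ`-integrable (the shape in which the
  Rao clause is consumed).  HONEST LABEL: HC_CM is proved only modulo the 7 printed citations (2 remaining: hLiu418 =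
  stmt-HodgeConjecture-24832, h413 = stmt-HodgeConjecture-24833) until rung 0 closes; this file is generic measure theory
  and proves nothing printed.

## References
* [DeitmarEchterhoff2014] A. Deitmar, S. Echterhoff, *Principles of Harmonic Analysis*, 2nd ed. (2014), Thm. 1.5.3
  (quotient integral formula), Lemma 9.3.3.
* [Rao1972] R. Ranga Rao, *Orbital integrals in reductive groups*, Ann. of Math. (2) 96 (1972) 505–510, Theorem (p. 505).
* [HarishChandra1999AdmissibleDistributions] Harish-Chandra, *Admissible Invariant Distributions on Reductive p-adic Groups*,
  AMS University Lecture Series 16 (1999), §3.1 p. 17.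
* [Folland1995] G. B. Folland, *A Course in Abstract Harmonic Analysis* (1995), §2.6 Thm. 2.49, (2.52).
-/

noncomputable section

open _root_.MeasureTheory _root_.MeasureTheory.Measure _root_.Topology Set Filter
open scoped ENNReal NNReal Pointwise

namespace Literature.MeasureTheory.Group

/-! ### §1 Doubling of a left-invariant measure along a strict chain of subgroups -/

section Chain

variable {H : Type*} [Group H] [MeasurableSpace H] [MeasurableMul H] (ρ : Measure H) [ρ.IsMulLeftInvariant]

/-- **Strict inclusion doubles the mass**: for subgroups `S < S'` with `S` measurable and a left-invariant measure `ρ`,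
`2·ρ(S) ≤ ρ(S')` — pick `x ∈ S' ∖ S`; then `S` and `x·S` are disjoint subsets of `S'` of the same measure.
[cite: DeitmarEchterhoff2014, Thm. 1.5.3] -/
theorem two_mul_measure_le_of_lt {S S' : Subgroup H} (hlt : S < S') (hS : MeasurableSet (S : Set H)) :
    2 * ρ S ≤ ρ S' := by
  obtain ⟨x, hxS', hxS⟩ := SetLike.exists_of_lt hlt
  have hle : S ≤ S' := hlt.le
  have himg : (fun h => x * h) '' (S : Set H) = (fun h => x⁻¹ * h) ⁻¹' (S : Set H) := by
    ext h
    constructor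
    · rintro ⟨s, hs, rfl⟩
      simpa [inv_mul_cancel_left] using hs
    · intro hh
      exact ⟨x⁻¹ * h, hh, by simp⟩
  have hmeas : MeasurableSet ((fun h => x * h) '' (S : Set H)) := by
    rw [himg]; exact (measurable_const_mul x⁻¹) hS
  have hρimg : ρ ((fun h => x * h) '' (S : Set H)) = ρ S := by
    rw [himg]; exact measure_preimage_mul ρ x⁻¹ _
  have hdisj : Disjoint (S : Set H) ((fun h => x * h) '' (S : Set H)) := by
    rw [Set.disjoint_left]
    rintro h hh ⟨s, hs, rfl⟩
    exact hxS ((S.mul_mem_cancel_right hs).1 hh)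
  have hsub : (S : Set H) ∪ (fun h => x * h) '' (S : Set H) ⊆ (S' : Set H) := by
    rintro h (hh | ⟨s, hs, rfl⟩)
    · exact hle hh
    · exact S'.mul_mem hxS' (hle hs)
  calc 2 * ρ S = ρ S + ρ ((fun h => x * h) '' (S : Set H)) := by rw [hρimg, two_mul]
    _ = ρ ((S : Set H) ∪ (fun h => x * h) '' (S : Set H)) := (measure_union hdisj hmeas).symm
    _ ≤ ρ S' := measure_mono hsub

/-- **Doubling along a strict chain**: for measurable subgroups `S₀ < S₁ < S₂ < ⋯`, `2^j · ρ(S₀) ≤ ρ(S_j)`.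
[cite: DeitmarEchterhoff2014, Thm. 1.5.3] -/
theorem pow_mul_measure_le_of_chain (S : ℕ → Subgroup H) (hlt : ∀ j, S j < S (j + 1))
    (hS : ∀ j, MeasurableSet (S j : Set H)) (j : ℕ) :
    2 ^ j * ρ (S 0) ≤ ρ (S j) := by
  induction j with
  | zero => simp
  | succ j ih =>
    calc (2 : ℝ≥0∞) ^ (j + 1) * ρ (S 0) = 2 * (2 ^ j * ρ (S 0)) := by ring
      _ ≤ 2 * ρ (S j) := by gcongr
      _ ≤ ρ (S (j + 1)) := two_mul_measure_le_of_lt ρ (hlt j) (hS j)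

end Chain

/-! ### §2 The adapted unfolding bound `μ(π(W))·ρ(S) ≤ c·ν(W)` -/

section Adapted

variable {G : Type*} [Group G] [TopologicalSpace G] [IsTopologicalGroup G] [LocallyCompactSpace G]
  [SecondCountableTopology G] [T2Space G] [MeasurableSpace G] [BorelSpace G]
  (H : Subgroup G) [hH : IsClosed (H : Set G)]
  (ρ : Measure H) [ρ.IsMulLeftInvariant] [IsFiniteMeasureOnCompacts ρ]
  [MeasurableSpace (G ⧸ H)] [BorelSpace (G ⧸ H)]
  (μ : Measure (G ⧸ H)) [IsFiniteMeasureOnCompacts μ] [SMulInvariantMeasure G (G ⧸ H) μ]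
  (ν : Measure G) [IsHaarMeasure ν]

/-- **Unfolding against an adapted pair**: if `W ⊆ G` is open, `S ⊆ H` is measurable and `W·S ⊆ W`, then
`μ(π(W))·ρ(S) ≤ c·ν(W)`, `c = unfoldingConstant H ρ μ ν` — Weil's formula ★ `lintegral_fiberLIntegral_eq_mul_lintegral` on
`f = 1_W`, whose fibre integral `∫_H 1_W(w h) dρ(h)` is at least `ρ(S)` at every `w ∈ W`. [cite: DeitmarEchterhoff2014, Thm. 1.5.3] -/
theorem measure_image_mk_mul_le_unfoldingConstant_mul {W : Set G} (hW : IsOpen W) {S : Set H}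
    (hS : MeasurableSet S) (hWS : ∀ w ∈ W, ∀ s ∈ S, w * (s : G) ∈ W) :
    μ ((QuotientGroup.mk : G → G ⧸ H) '' W) * ρ S ≤ unfoldingConstant H ρ μ ν * ν W := by
  have hWm : MeasurableSet W := hW.measurableSet
  have h := lintegral_fiberLIntegral_eq_mul_lintegral H ρ μ ν
    ((measurable_one.indicator hWm : Measurable (W.indicator (1 : G → ℝ≥0∞))))
  rw [lintegral_indicator_one hWm] at h
  rw [← h]
  have hπW : MeasurableSet ((QuotientGroup.mk : G → G ⧸ H) '' W) :=
    (QuotientGroup.isOpenMap_coe W hW).measurableSet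
  calc μ ((QuotientGroup.mk : G → G ⧸ H) '' W) * ρ S
        = ∫⁻ x, ((QuotientGroup.mk : G → G ⧸ H) '' W).indicator (fun _ => ρ S) x ∂μ := by
          rw [lintegral_indicator_const hπW, mul_comm]
    _ ≤ ∫⁻ x, fiberLIntegral H ρ (W.indicator 1) x ∂μ := by
          refine lintegral_mono fun x => ?_
          by_cases hx : x ∈ (QuotientGroup.mk : G → G ⧸ H) '' W
          · obtain ⟨w, hw, rfl⟩ := hx
            rw [Set.indicator_of_mem (Set.mem_image_of_mem _ hw), fiberLIntegral_mk]
            calc ρ S = ∫⁻ h, S.indicator 1 h ∂ρ := (lintegral_indicator_one hS).symm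
              _ ≤ ∫⁻ h, W.indicator 1 (w * (h : G)) ∂ρ := by
                  refine lintegral_mono fun h => ?_
                  by_cases hh : h ∈ S
                  · rw [Set.indicator_of_mem hh, Set.indicator_of_mem (hWS w hw h hh)]
                    simp only [Pi.one_apply, le_refl]
                  · rw [Set.indicator_of_notMem hh]; exact zero_le
          · rw [Set.indicator_of_notMem hx]; exact zero_le

variable [ρ.IsOpenPosMeasure]

include ρ ν in
/-- **Every right translate `K g` of a compact open subgroup has finite `μ`-image**: `μ(π(K g)) < ∞` — §2 with `W = K g`,
`S = H ∩ g⁻¹Kg` (open in `H`, so `ρ(S) > 0`), `ν(K g) = ν(K) < ∞`. [cite: DeitmarEchterhoff2014, Thm. 1.5.3] -/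
theorem measure_image_mk_mul_singleton_lt_top (K : Subgroup G) (hKo : IsOpen (K : Set G))
    (hKc : IsCompact (K : Set G)) (g : G) :
    μ ((QuotientGroup.mk : G → G ⧸ H) '' ((K : Set G) * {g})) < ∞ := by
  -- the adapted pair `W = K g`, `S = {s ∈ H | g s g⁻¹ ∈ K}`
  set W : Set G := (K : Set G) * {g} with hWdef
  set S : Set H := {s : H | g * (s : G) * g⁻¹ ∈ K} with hSdef
  have hWo : IsOpen W := by
    rw [hWdef, Set.mul_singleton]; exact (Homeomorph.mulRight g).isOpenMap _ hKo
  have hcont : Continuous fun s : H => g * (s : G) * g⁻¹ := by fun_prop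
  have hSo : IsOpen S := hKo.preimage hcont
  have hSm : MeasurableSet S := hSo.measurableSet
  have hWS : ∀ w ∈ W, ∀ s ∈ S, w * (s : G) ∈ W := by
    intro w hw s hs
    rw [hWdef, Set.mul_singleton] at hw ⊢
    obtain ⟨k, hk, rfl⟩ := hw
    exact ⟨k * (g * (s : G) * g⁻¹), K.mul_mem hk hs, by simp [mul_assoc]⟩
  have hle := measure_image_mk_mul_le_unfoldingConstant_mul H ρ μ ν hWo hSm hWS
  have hρS : 0 < ρ S := hSo.measure_pos ρ ⟨1, by simp [hSdef, K.one_mem]⟩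
  have hνW : ν W < ∞ := by
    rw [hWdef, Set.mul_singleton]
    exact (hKc.image (Homeomorph.mulRight g).continuous).measure_lt_top
  have hfin : (unfoldingConstant H ρ μ ν : ℝ≥0∞) * ν W < ∞ := ENNReal.mul_lt_top ENNReal.coe_lt_top hνW
  by_contra htop
  rw [not_lt, top_le_iff] at htop
  rw [htop, ENNReal.top_mul hρS.ne'] at hle
  exact hfin.ne (top_le_iff.1 hle)

variable [ν.IsMulRightInvariant]

include ρ ν in
/-- **MAIN LEMMA — finiteness along a contracting element.**  Let `K` be a compact open subgroup and `a ∈ G` an element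
NORMALISING `H` such that `Ad(a)` improves `K`-integrality on `H` (`h ∈ H ∩ K ⇒ a h a⁻¹ ∈ K`) STRICTLY (some `h ∈ H ∖ K`
has `a h a⁻¹ ∈ K`).  Then `μ(⋃_{j ≥ j₀} π(K a^j)) < ∞` for every `j₀ : ℤ`: with `S_j = H ∩ a^{−j} K a^{j}` one has
`K a^j · S_j ⊆ K a^j`, `S_0 < S_1 < ⋯` (conjugation by `a⁻¹` carries a witness of `S_0 < S_1` to one of `S_j < S_{j+1}`), so by
§1–§2 `μ(π(K a^j)) ≤ c·ν(K) ∕ (2^j ρ(S_0))` for `j ≥ 0`, a convergent geometric series; the finitely many `j < 0` are finite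
one by one.  (The rank-one mechanism of Ranga Rao's theorem: `K a^j G_u ∕ G_u` are the level-`j` shells of a unipotent orbit.)
[cite: Rao1972, Theorem] [cite: HarishChandra1999AdmissibleDistributions, §3.1 p. 17] [cite: DeitmarEchterhoff2014, Thm. 1.5.3] -/
theorem measure_iUnion_image_mk_mul_zpow_lt_top (K : Subgroup G) (hKo : IsOpen (K : Set G))
    (hKc : IsCompact (K : Set G)) (a : G) (ha : ∀ h : G, h ∈ H ↔ a * h * a⁻¹ ∈ H)
    (hK : ∀ h : G, h ∈ H → h ∈ K → a * h * a⁻¹ ∈ K)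
    (hstrict : ∃ h : G, h ∈ H ∧ h ∉ K ∧ a * h * a⁻¹ ∈ K) (j₀ : ℤ) :
    μ (⋃ j ∈ {j : ℤ | j₀ ≤ j}, (QuotientGroup.mk : G → G ⧸ H) '' ((K : Set G) * {a ^ j})) < ∞ := by
  -- the chain `S_j = {s ∈ H | a^j s a^{-j} ∈ K}` of open subgroups of `H`
  let S : ℕ → Subgroup H := fun j => K.comap ((MulAut.conj (a ^ j)).toMonoidHom.comp H.subtype)
  have hSmem : ∀ (j : ℕ) (s : H), s ∈ S j ↔ a ^ j * (s : G) * (a ^ j)⁻¹ ∈ K := fun j s => Iff.rfl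
  have hSo : ∀ j, IsOpen (S j : Set H) := fun j => by
    have hc : Continuous fun s : H => a ^ j * (s : G) * (a ^ j)⁻¹ := by fun_prop
    exact hKo.preimage hc
  have hSmeas : ∀ j, MeasurableSet (S j : Set H) := fun j => (hSo j).measurableSet
  -- conjugates by powers of `a` (and of `a⁻¹`) of elements of `H` stay in `H`
  have haH : ∀ (n : ℕ) (h : G), h ∈ H → a ^ n * h * (a ^ n)⁻¹ ∈ H := by
    intro n
    induction n with
    | zero => intro h hh; simpa using hh
    | succ n ih =>
      intro h hh
      have e : a ^ (n + 1) * h * (a ^ (n + 1))⁻¹ = a * (a ^ n * h * (a ^ n)⁻¹) * a⁻¹ := by rw [pow_succ']; group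
      rw [e]; exact (ha _).1 (ih h hh)
  have haHinv : ∀ h : G, h ∈ H → a⁻¹ * h * a ∈ H := fun h hh =>
    (ha (a⁻¹ * h * a)).2 (by simpa [mul_assoc] using hh)
  -- the chain is strict
  have hlt : ∀ j, S j < S (j + 1) := by
    intro j
    obtain ⟨h₀, hh₀H, hh₀K, hah₀⟩ := hstrict
    have hxH : (a ^ j)⁻¹ * h₀ * a ^ j ∈ H := by
      induction j with
      | zero => simpa using hh₀H
      | succ n ih =>
        have e : (a ^ (n + 1))⁻¹ * h₀ * a ^ (n + 1) = a⁻¹ * ((a ^ n)⁻¹ * h₀ * a ^ n) * a := by rw [pow_succ']; group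
        rw [e]; exact haHinv _ ih
    refine SetLike.lt_iff_le_and_exists.2 ⟨?_, ⟨⟨(a ^ j)⁻¹ * h₀ * a ^ j, hxH⟩, ?_, ?_⟩⟩
    · intro s hs
      rw [hSmem] at hs ⊢
      have e : a ^ (j + 1) * (s : G) * (a ^ (j + 1))⁻¹ = a * (a ^ j * (s : G) * (a ^ j)⁻¹) * a⁻¹ := by
        rw [pow_succ']; group
      rw [e]
      exact hK _ (haH j _ s.2) hs
    · rw [hSmem]
      have e : a ^ (j + 1) * ((a ^ j)⁻¹ * h₀ * a ^ j) * (a ^ (j + 1))⁻¹ = a * h₀ * a⁻¹ := by rw [pow_succ']; group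
      rw [e]; exact hah₀
    · rw [hSmem]
      have e : a ^ j * ((a ^ j)⁻¹ * h₀ * a ^ j) * (a ^ j)⁻¹ = h₀ := by group
      rw [e]; exact hh₀K
  -- the constants
  have hνK : ν K < ∞ := hKc.measure_lt_top
  have hρ0 : 0 < ρ (S 0) := (hSo 0).measure_pos ρ ⟨1, (S 0).one_mem⟩
  have hρ0' : ρ (S 0) < ∞ := by
    have hc : IsCompact ((fun s : H => (s : G)) ⁻¹' (K : Set G)) := hH.isClosedEmbedding_subtypeVal.isCompact_preimage hKc
    refine lt_of_le_of_lt (measure_mono fun s hs => ?_) hc.measure_lt_top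
    have hs' := (hSmem 0 s).1 hs
    simpa using hs'
  have hC : (unfoldingConstant H ρ μ ν : ℝ≥0∞) * ν K < ∞ := ENNReal.mul_lt_top ENNReal.coe_lt_top hνK
  -- the level-`j` bound, `j ≥ 0`
  have hbound : ∀ j : ℕ,
      μ ((QuotientGroup.mk : G → G ⧸ H) '' ((K : Set G) * {a ^ j})) * (2 ^ j * ρ (S 0)) ≤
        unfoldingConstant H ρ μ ν * ν K := by
    intro j
    have hWo : IsOpen ((K : Set G) * {a ^ j}) := by
      rw [Set.mul_singleton]; exact (Homeomorph.mulRight (a ^ j)).isOpenMap _ hKo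
    have hWS : ∀ w ∈ (K : Set G) * {a ^ j}, ∀ s ∈ (S j : Set H), w * (s : G) ∈ (K : Set G) * {a ^ j} := by
      intro w hw s hs
      rw [Set.mul_singleton] at hw ⊢
      obtain ⟨k, hk, rfl⟩ := hw
      exact ⟨k * (a ^ j * (s : G) * (a ^ j)⁻¹), K.mul_mem hk hs, by simp [mul_assoc]⟩
    have h1 := measure_image_mk_mul_le_unfoldingConstant_mul H ρ μ ν hWo (hSmeas j) hWS
    have hνW : ν ((K : Set G) * {a ^ j}) = ν K := by
      rw [Set.mul_singleton, Set.image_mul_right, measure_preimage_mul_right]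
    rw [hνW] at h1
    calc μ _ * (2 ^ j * ρ (S 0)) ≤ μ ((QuotientGroup.mk : G → G ⧸ H) '' ((K : Set G) * {a ^ j})) * ρ (S j) := by
          gcongr; exact pow_mul_measure_le_of_chain ρ S hlt hSmeas j
      _ ≤ _ := h1
  -- hence a geometric bound
  have hterm : ∀ j : ℕ, μ ((QuotientGroup.mk : G → G ⧸ H) '' ((K : Set G) * {a ^ j})) ≤
      (unfoldingConstant H ρ μ ν * ν K / ρ (S 0)) * (2⁻¹) ^ j := by
    intro j
    have h2j : (2 : ℝ≥0∞) ^ j ≠ 0 := pow_ne_zero _ two_ne_zero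
    have h2j' : (2 : ℝ≥0∞) ^ j ≠ ∞ := ENNReal.pow_ne_top ENNReal.ofNat_ne_top
    have hle : μ ((QuotientGroup.mk : G → G ⧸ H) '' ((K : Set G) * {a ^ j})) ≤
        unfoldingConstant H ρ μ ν * ν K / (2 ^ j * ρ (S 0)) := by
      rw [ENNReal.le_div_iff_mul_le (Or.inl (mul_ne_zero h2j hρ0.ne')) (Or.inl (ENNReal.mul_ne_top h2j' hρ0'.ne))]
      exact hbound j
    refine hle.trans (le_of_eq ?_)
    rw [div_eq_mul_inv, div_eq_mul_inv, ENNReal.mul_inv (Or.inl h2j) (Or.inl h2j'), ENNReal.inv_pow]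
    ring
  -- summability over `j ≥ 0`
  have hpos : μ (⋃ n : ℕ, (QuotientGroup.mk : G → G ⧸ H) '' ((K : Set G) * {a ^ (n : ℤ)})) < ∞ := by
    refine (measure_iUnion_le _).trans_lt ?_
    calc ∑' n : ℕ, μ ((QuotientGroup.mk : G → G ⧸ H) '' ((K : Set G) * {a ^ (n : ℤ)}))
          ≤ ∑' n : ℕ, (unfoldingConstant H ρ μ ν * ν K / ρ (S 0)) * (2⁻¹) ^ n :=
            ENNReal.tsum_le_tsum fun n => by rw [zpow_natCast]; exact hterm n
      _ = (unfoldingConstant H ρ μ ν * ν K / ρ (S 0)) * ∑' n : ℕ, ((2 : ℝ≥0∞)⁻¹) ^ n := ENNReal.tsum_mul_left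
      _ = (unfoldingConstant H ρ μ ν * ν K / ρ (S 0)) * 2 := by
            rw [ENNReal.tsum_geometric, ENNReal.one_sub_inv_two, inv_inv]
      _ < ∞ := ENNReal.mul_lt_top (ENNReal.div_lt_top hC.ne hρ0.ne') ENNReal.ofNat_lt_top
  -- the finitely many `j < 0`
  have hneg : μ (⋃ j ∈ Finset.Ico j₀ 0, (QuotientGroup.mk : G → G ⧸ H) '' ((K : Set G) * {a ^ j})) < ∞ :=
    measure_biUnion_lt_top (Finset.Ico j₀ 0).finite_toSet fun j _ =>
      measure_image_mk_mul_singleton_lt_top H ρ μ ν K hKo hKc (a ^ j)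
  -- assemble
  refine lt_of_le_of_lt (measure_mono ?_) ((measure_union_le _ _).trans_lt (ENNReal.add_lt_top.2 ⟨hneg, hpos⟩))
  intro x hx
  simp only [Set.mem_iUnion, Set.mem_setOf_eq, exists_prop] at hx
  obtain ⟨j, hj, hxj⟩ := hx
  rcases lt_or_ge j 0 with hjneg | hjpos
  · refine Or.inl ?_
    simp only [Set.mem_iUnion, Finset.mem_Ico, exists_prop]
    exact ⟨j, ⟨hj, hjneg⟩, hxj⟩
  · refine Or.inr ?_
    simp only [Set.mem_iUnion]
    refine ⟨j.toNat, ?_⟩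
    rwa [Int.toNat_of_nonneg hjpos]

end Adapted

/-! ### §4 From finite orbit-preimages of compacta to integrable orbital integrands -/

section Integrable

variable {G : Type*} [Group G] [TopologicalSpace G] [IsTopologicalGroup G] [MeasurableSpace G] [BorelSpace G]
  (γ₀ : G) (M : Subgroup G) (hM : ∀ m ∈ M, m * γ₀ = γ₀ * m)
  [MeasurableSpace (G ⧸ M)] [BorelSpace (G ⧸ M)]
  {E : Type*} [NormedAddCommGroup E]

/-- **Integrability of orbital integrands from the finiteness of orbit-preimages of compacta** (the form in which Ranga
Rao's theorem is consumed): if `μ{y M ∣ y γ₀ y⁻¹ ∈ C} < ∞` for every compact `C ⊆ G`, then for every continuous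
compactly supported `f` the orbital integrand `y M ↦ f(y γ₀ y⁻¹)` is `μ`-integrable — it is Borel, bounded by `sup ‖f‖`,
and vanishes off the finite-measure set `{y M ∣ y γ₀ y⁻¹ ∈ tsupport f}`. [cite: Rao1972, Theorem]
[cite: DeitmarEchterhoff2014, Lemma 9.3.3] -/
theorem integrable_descConj_of_measure_preimage_lt_top (μ : Measure (G ⧸ M))
    (hfin : ∀ C : Set G, IsCompact C → μ ((descConj γ₀ M hM id) ⁻¹' C) < ∞)
    {f : G → E} (hfc : Continuous f) (hf : HasCompactSupport f) :
    Integrable (descConj γ₀ M hM f) μ := by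
  have heq : descConj γ₀ M hM f = f ∘ descConj γ₀ M hM id := descConj_eq_comp γ₀ M hM f
  have horb : Continuous (descConj γ₀ M hM id) := continuous_descConj γ₀ M hM continuous_id
  have hAfin : μ ((descConj γ₀ M hM id) ⁻¹' tsupport f) < ∞ := hfin _ hf
  obtain ⟨C, hC⟩ := hfc.bounded_above_of_compact_support hf
  have hmeas : AEStronglyMeasurable (descConj γ₀ M hM f) μ := by
    rw [heq]
    exact ((hfc.stronglyMeasurable_of_hasCompactSupport hf).comp_measurable horb.measurable).aestronglyMeasurable
  have hsupp : Function.support (descConj γ₀ M hM f) ⊆ (descConj γ₀ M hM id) ⁻¹' tsupport f := by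
    intro x hx
    rw [heq] at hx
    exact subset_tsupport f hx
  rw [← integrableOn_iff_integrable_of_support_subset hsupp]
  exact Measure.integrableOn_of_bounded hAfin.ne hmeas
    (Eventually.of_forall fun x => by rw [heq]; exact hC _)

end Integrable

end Literature.MeasureTheory.Group

end
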